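import Summits.QuantumFields.QCD.Theorems.HeatSlicedQuarksQuarkLoopCoefficientSecondOrderExpansionAuxK

/-!
# Second-order expansion of the heat symbol — part L: the Gaussian bound of `R₂`
(line `Sketch` of crux stmt-QuantumFields-16786, stub `stub_secondOrderExpansion`, helper file)

Under the Gaussian majorant of the heat symbol (`‖E_θ(t)(w)_{αβ}‖ ≤ C_E Γ_{c_E}(t,w)` for `|θ| ≤ c₀`,
`|θ| t ≤ c₀`) and the twisted Duhamel representation of part L, the second-order remainder obeys
`‖(E_θ − E₀ − θE₁)(t)(w)_{αβ}‖ ≤ C_R θ² (1+t)² Γ_{c₁/2}(t,w)`, `c₁ = min c_E (c_k/8)`.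
Also: series of products of spin-matrix fields at the origin (phase-free twisted convolutions):
summability, entry bound, and continuity in a parameter (for the time integrals of part N).
-/

noncomputable section

namespace Summit.QuantumFields.QCD.Cruxes.QuarkLoopCoefficient.Sketch.SecondOrderExpansion

open Literature.MathematicalPhysics.QuantumLattice Literature.MathematicalPhysics.QuantumFieldTheory
open Literature.Probability.LatticeModels (Site)
open Summit.QuantumFields.QCD.Theorems.QuarkLoopCoefficient
open Summit.QuantumFields.QCD.Cruxes.QuarkLoopCoefficient.Sketch.HeatSeries
open Summit.QuantumFields.QCD.Cruxes.QuarkLoopCoefficient.Sketch.FreeMajorantToolkit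
open Summit.QuantumFields.QCD.Cruxes.QuarkLoopCoefficient.Sketch.SymmetricGauge
open scoped Matrix ComplexConjugate

/-- The twisted generator `(V_θ f)(w) = Σ_{v ∈ nbr2 0} Ω_θ(v, w) • (ȟ_θ(v) f(w − v))` (local notation). -/
local notation "V[" θ "]" => (fun (f : Site 4 → Spin) (w : Site 4) =>
  ∑ v ∈ nbr2 0, Complex.exp (((θ / 2 * (wedge v w : ℤ) : ℝ) : ℂ) * Complex.I) • (sqKer (symLink θ) 0 v * f (w - v)))

/-- The second-order forcing `q₂(θ, s, w)` (local notation). -/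
local notation "Q₂[" θ "," s "," w "]" => (V[θ] (pert0 s) w + (θ : ℂ) • V[θ] (pert1 s) w - vtx 0 (pert0 s) w -
  (θ : ℂ) • (vtx 0 (pert1 s) w + vtx 1 (pert0 s) w))

/-! ## §29 Products of profile-bounded fields summed over the lattice, at the origin -/

/-- Entries of a lattice series of spin matrices. -/
theorem tsum_apply_apply {M : Site 4 → Spin} (hM : Summable M) (α β : Fin 4) :
    (∑' y : Site 4, M y) α β = ∑' y : Site 4, M y α β := by
  have e1 : (∑' y : Site 4, M y) α = ∑' y : Site 4, M y α := tsum_apply hM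
  have e2 : (∑' y : Site 4, M y α) β = ∑' y : Site 4, M y α β := tsum_apply (Pi.summable.mp hM α)
  rw [show (∑' y : Site 4, M y) α β = ((∑' y : Site 4, M y) α) β from rfl, e1, e2]

/-- **Phase-free convolution bound at the origin**: if `‖E(y)_{αγ}‖ ≤ a Γ_{c/2}(u,y)` and
`‖q(y)_{γβ}‖ ≤ b Γ_c(s,y)`, then `y ↦ E(y) q(−y)` is summable and
`‖(Σ_y E(y) q(−y))_{αβ}‖ ≤ 4 a b B Γ_{c/2}(u+s, 0)`. -/
theorem originConv_summable_and_norm_le {c B : ℝ}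
    (hB : ∀ a b : ℝ, 0 ≤ a → 0 ≤ b → ∀ w : Site 4,
      Summable (fun y : Site 4 => gaussProfile ((1 - 1 / 2) * c) a y * gaussProfile c b (w - y)) ∧
      ∑' y : Site 4, gaussProfile ((1 - 1 / 2) * c) a y * gaussProfile c b (w - y) ≤
        B * gaussProfile ((1 - 1 / 2) * c) (a + b) w)
    {E q : Site 4 → Spin} {a b u s : ℝ} (ha : 0 ≤ a) (hb : 0 ≤ b) (hu : 0 ≤ u) (hs : 0 ≤ s)
    (hE : ∀ (y : Site 4) (α γ : Fin 4), ‖E y α γ‖ ≤ a * gaussProfile (c / 2) u y)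
    (hq : ∀ (y : Site 4) (γ β : Fin 4), ‖q y γ β‖ ≤ b * gaussProfile c s y) :
    Summable (fun y : Site 4 => E y * q (-y)) ∧
    ∀ α β : Fin 4, ‖(∑' y : Site 4, E y * q (-y)) α β‖ ≤ 4 * a * b * B * gaussProfile (c / 2) (u + s) 0 := by
  obtain ⟨hS, hle⟩ := twistedConv_summable_and_norm_le hB 0 ha hb hu hs hE hq 0
  have hfun : (fun y : Site 4 => Complex.exp ((((0 : ℝ) / 2 * (wedge y 0 : ℤ) : ℝ) : ℂ) * Complex.I) •
      (E y * q (0 - y))) = fun y : Site 4 => E y * q (-y) := by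
    funext y; rw [cexp_wedge_zero, one_smul, zero_sub]
  rw [hfun] at hS hle
  exact ⟨hS, hle⟩

/-- **Continuity in a parameter of a lattice series of products**, with a uniform summable majorant:
if the entries of `A s y`, `B s y` are continuous in `s ∈ S`, `‖A s y‖ ≤ a Γ_c(T,y)` and `‖B s y‖ ≤ b`
uniformly on `S`, then `s ↦ (Σ_y A s y * B s (−y))_{αβ}` is continuous on `S`. -/
theorem continuousOn_tsum_mul_apply {A B : ℝ → Site 4 → Spin} {S : Set ℝ} {a b c T : ℝ}
    (hΓ : Summable (fun y : Site 4 => gaussProfile c T y))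
    (hA : ∀ (y : Site 4) (γ δ : Fin 4), ContinuousOn (fun s : ℝ => A s y γ δ) S)
    (hB : ∀ (y : Site 4) (γ δ : Fin 4), ContinuousOn (fun s : ℝ => B s y γ δ) S)
    (hAb : ∀ s ∈ S, ∀ (y : Site 4) (γ δ : Fin 4), ‖A s y γ δ‖ ≤ a * gaussProfile c T y)
    (hBb : ∀ s ∈ S, ∀ (y : Site 4) (γ δ : Fin 4), ‖B s y γ δ‖ ≤ b) (α β : Fin 4) :
    ContinuousOn (fun s : ℝ => ∑' y : Site 4, (A s y * B s (-y)) α β) S := by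
  refine continuousOn_tsum (u := fun y : Site 4 => 4 * a * b * gaussProfile c T y) (fun y => ?_)
    (hΓ.mul_left (4 * a * b)) (fun y s hs => ?_)
  · simp only [Matrix.mul_apply]
    exact continuousOn_finsetSum _ fun γ _ => (hA y α γ).mul (hB (-y) γ β)
  · have := norm_mul_apply_le (hAb s hs y) (hBb s hs (-y)) α β
    linarith

/-! ## §30 The Gaussian bound of the second-order remainder -/

/-- **Bound of `R₂`.**  Under the Gaussian majorant of the heat symbol and the twisted Duhamel
representation: `‖(E_θ − E₀ − θE₁)(t)(w)_{αβ}‖ ≤ C_R θ² (1+t)² Γ_{c₁/2}(t,w)` for `0 ≤ t`, `|θ| ≤ c₀`,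
`|θ| t ≤ c₀`, where `c₁ = min c_E (c_k/8)`. -/
theorem exists_remainder₂_bound {Ck ck c₀ CE cE : ℝ} (hck : 0 < ck) (hc₀ : 0 < c₀) (hcE : 0 < cE)
    (hk : ∀ t : ℝ, 0 ≤ t → ∀ w : Site 4, |freeKer t w| ≤ Ck * gaussProfile ck t w)
    (hT2 : ∀ c ε : ℝ, 0 < c → 0 < ε → ε < 1 → ∃ B : ℝ, ∀ a b : ℝ, 0 ≤ a → 0 ≤ b → ∀ w : Site 4,
      Summable (fun y : Site 4 => gaussProfile ((1 - ε) * c) a y * gaussProfile c b (w - y)) ∧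
      ∑' y : Site 4, gaussProfile ((1 - ε) * c) a y * gaussProfile c b (w - y) ≤
        B * gaussProfile ((1 - ε) * c) (a + b) w)
    (hT3 : ∀ c ε : ℝ, 0 < c → 0 < ε → ε < 1 → ∀ j : ℕ, ∃ A : ℝ, ∀ t : ℝ, 0 ≤ t → ∀ w : Site 4,
      elen w ^ j * gaussProfile c t w ≤ A * Real.sqrt (1 + t) ^ j * gaussProfile ((1 - ε) * c) t w)
    (hT4 : ∀ c ε : ℝ, 0 < c → 0 < ε → ε < 1 → ∃ A : ℝ, ∀ t : ℝ, 0 ≤ t → ∀ w z : Site 4, elen z ≤ 2 →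
      gaussProfile c t (w + z) ≤ A * gaussProfile ((1 - ε) * c) t w)
    (h1 : ∀ x y : Site 4, sqKer (fun _ => (1 : ℂ)) x y = ((hhat (y - x) : ℝ) : ℂ) • (1 : Spin))
    (h3 : ∀ w : Site 4, freeKer 0 w = if w = 0 then 1 else 0)
    (h4 : ∀ (t : ℝ) (w : Site 4),
      HasDerivAt (fun s => freeKer s w) (-(∑ z ∈ nbr2 0, hhat z * freeKer t (w - z))) t)
    (h5 : ∀ s r : ℝ, 0 ≤ s → 0 ≤ r → ∀ w : Site 4,
      HasSum (fun y : Site 4 => freeKer s y * freeKer r (w - y)) (freeKer (s + r) w))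
    (h6 : ∀ t : ℝ, 0 ≤ t → ∀ (w : Site 4) (ν : Fin 4),
      t * (∑ z ∈ nbr2 0, ((z ν : ℤ) : ℝ) * hhat z * freeKer t (w - z)) + ((w ν : ℤ) : ℝ) * freeKer t w = 0)
    (hTD : ∀ (θ T c B : ℝ), 0 < T → 0 < c → ∀ (X q : ℝ → Site 4 → Spin),
      (∀ w : Site 4, X 0 w = 0) →
      (∀ (w : Site 4) (α β : Fin 4), ContinuousOn (fun s => X s w α β) (Set.Icc 0 T)) →
      (∀ (w : Site 4) (α β : Fin 4), ContinuousOn (fun s => q s w α β) (Set.Icc 0 T)) →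
      (∀ s ∈ Set.Ioo 0 T, ∀ (w : Site 4) (α β : Fin 4),
        HasDerivAt (fun r => X r w α β)
          ((-(∑ v ∈ nbr2 0, Complex.exp (((θ / 2 * (wedge v w : ℤ) : ℝ) : ℂ) * Complex.I) •
              (sqKer (symLink θ) 0 v * X s (w - v))) - q s w) α β) s) →
      (∀ s ∈ Set.Icc 0 T, ∀ (w : Site 4) (α β : Fin 4), ‖X s w α β‖ ≤ B) →
      (∀ s ∈ Set.Icc 0 T, ∀ (w : Site 4) (α β : Fin 4), ‖q s w α β‖ ≤ B * gaussProfile c s w) →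
      ∀ t ∈ Set.Icc 0 T, ∀ (w : Site 4) (α β : Fin 4),
        X t w α β = -∫ s in (0 : ℝ)..t, (∑' y : Site 4,
          Complex.exp (((θ / 2 * (wedge y w : ℤ) : ℝ) : ℂ) * Complex.I) •
            (symHeat θ (t - s) y * q s (w - y))) α β)
    (hGM : ∀ θ t : ℝ, 0 ≤ t → |θ| ≤ c₀ → |θ| * t ≤ c₀ →
      ∀ (w : Site 4) (α β : Fin 4), ‖symHeat θ t w α β‖ ≤ CE * gaussProfile cE t w) :
    ∃ CR : ℝ, 0 ≤ CR ∧ ∀ θ t : ℝ, 0 ≤ t → |θ| ≤ c₀ → |θ| * t ≤ c₀ → ∀ (w : Site 4) (α β : Fin 4),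
      ‖(symHeat θ t w - pert0 t w - (θ : ℂ) • pert1 t w) α β‖ ≤
        CR * θ ^ 2 * (1 + t) ^ 2 * gaussProfile (min cE (ck / 8) / 2) t w := by
  set c₁ : ℝ := min cE (ck / 8) with hc₁
  have hc₁0 : 0 < c₁ := lt_min hcE (by positivity)
  obtain ⟨Bm, hBm⟩ := hT2 c₁ (1 / 2) hc₁0 (by norm_num) (by norm_num)
  obtain ⟨K, hK0, hq⟩ := exists_forcing_bounds hck hk hT3 hT4 h1 h3 h5 h6
  have hCE : 0 ≤ CE := by
    have := hGM 0 0 le_rfl (by simp [hc₀.le]) (by simp [hc₀.le]) 0 0 0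
    have h0 : 0 < gaussProfile cE 0 0 := by rw [gaussProfile_zero_right]; norm_num
    nlinarith [norm_nonneg (symHeat 0 0 0 0 0)]
  -- replace `Bm` by a nonnegative constant
  have hBm' : ∀ a b : ℝ, 0 ≤ a → 0 ≤ b → ∀ w : Site 4,
      Summable (fun y : Site 4 => gaussProfile ((1 - 1 / 2) * c₁) a y * gaussProfile c₁ b (w - y)) ∧
      ∑' y : Site 4, gaussProfile ((1 - 1 / 2) * c₁) a y * gaussProfile c₁ b (w - y) ≤
        max Bm 0 * gaussProfile ((1 - 1 / 2) * c₁) (a + b) w :=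
    fun a b ha hb w => ⟨(hBm a b ha hb w).1, (hBm a b ha hb w).2.trans
      (mul_le_mul_of_nonneg_right (le_max_left _ _) (gaussProfile_nonneg _ _ _))⟩
  refine ⟨4 * CE * (K * (1 + 2 * c₀)) * max Bm 0, by positivity, fun θ t ht hθ hθt w α β => ?_⟩
  have hΓ := gaussProfile_nonneg (c₁ / 2) t w
  rcases ht.eq_or_lt with h0 | htpos
  · -- `t = 0`: the remainder vanishes
    rw [← h0, remainder₂_zero h1 h3 h5 h6 θ w]
    simp only [Matrix.zero_apply, norm_zero]
    exact mul_nonneg (by positivity) (gaussProfile_nonneg _ _ _)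
  -- `t > 0`: Duhamel representation and the pointwise bound of the integrand
  rw [remainder₂_eq_integral hck hk hT3 hT4 h1 h3 h4 h5 h6 hTD θ htpos w α β, norm_neg]
  have hpt : ∀ s ∈ Set.Ioc 0 t, ‖(∑' y : Site 4,
      Complex.exp (((θ / 2 * (wedge y w : ℤ) : ℝ) : ℂ) * Complex.I) •
        (symHeat θ (t - s) y * Q₂[θ, s, w - y])) α β‖ ≤
      4 * CE * (K * (1 + 2 * c₀) * θ ^ 2 * (1 + t)) * max Bm 0 * gaussProfile (c₁ / 2) t w := by
    intro s hs
    have hs0 : 0 ≤ s := hs.1.le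
    have hts : 0 ≤ t - s := by linarith [hs.2]
    -- the two profile bounds
    have hE : ∀ (y : Site 4) (α γ : Fin 4), ‖symHeat θ (t - s) y α γ‖ ≤ CE * gaussProfile (c₁ / 2) (t - s) y := by
      intro y α γ
      refine (hGM θ (t - s) hts hθ ?_ y α γ).trans (mul_le_mul_of_nonneg_left ?_ hCE)
      · calc |θ| * (t - s) ≤ |θ| * t := by gcongr; linarith
          _ ≤ c₀ := hθt
      · exact gaussProfile_anti (by rw [hc₁]; linarith [min_le_left cE (ck / 8)]) hts y
    have hQ : ∀ (y : Site 4) (γ β : Fin 4), ‖(Q₂[θ, s, y]) γ β‖ ≤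
        K * (1 + 2 * c₀) * θ ^ 2 * (1 + t) * gaussProfile c₁ s y := by
      intro y γ β
      refine ((hq θ s hs0 y γ β).2.2.1).trans ?_
      have hΓ' := gaussProfile_nonneg (ck / 8) s y
      have hmono : gaussProfile (ck / 8) s y ≤ gaussProfile c₁ s y :=
        gaussProfile_anti (min_le_right _ _) hs0 y
      have hθs : |θ| * (1 + s) ≤ 2 * c₀ := by nlinarith [hs.2, abs_nonneg θ]
      have hpoly : θ ^ 2 * (1 + s) + |θ| ^ 3 * (1 + s) ^ 2 ≤ (1 + 2 * c₀) * θ ^ 2 * (1 + t) := by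
        have e : |θ| ^ 3 * (1 + s) ^ 2 = θ ^ 2 * (1 + s) * (|θ| * (1 + s)) := by
          rw [show |θ| ^ 3 = |θ| ^ 2 * |θ| by ring, sq_abs]; ring
        rw [e]
        have h2 : 0 ≤ θ ^ 2 * (1 + s) := by positivity
        have h3 : θ ^ 2 * (1 + s) ≤ θ ^ 2 * (1 + t) := by gcongr; linarith [hs.2]
        nlinarith [mul_le_mul_of_nonneg_left hθs h2]
      calc K * (θ ^ 2 * (1 + s) + |θ| ^ 3 * (1 + s) ^ 2) * gaussProfile (ck / 8) s y
          ≤ K * ((1 + 2 * c₀) * θ ^ 2 * (1 + t)) * gaussProfile c₁ s y := by gcongr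
        _ = _ := by ring
    have key := (twistedConv_summable_and_norm_le hBm' θ hCE (by positivity) hts hs0 hE hQ w).2 α β
    rwa [sub_add_cancel] at key
  calc ‖∫ s in (0 : ℝ)..t, (∑' y : Site 4,
        Complex.exp (((θ / 2 * (wedge y w : ℤ) : ℝ) : ℂ) * Complex.I) •
          (symHeat θ (t - s) y * Q₂[θ, s, w - y])) α β‖
      ≤ 4 * CE * (K * (1 + 2 * c₀) * θ ^ 2 * (1 + t)) * max Bm 0 * gaussProfile (c₁ / 2) t w * |t - 0| :=
        intervalIntegral.norm_integral_le_of_norm_le_const fun s hs => hpt s (by rwa [Set.uIoc_of_le ht] at hs)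
    _ = 4 * CE * (K * (1 + 2 * c₀)) * max Bm 0 * θ ^ 2 * ((1 + t) * t) * gaussProfile (c₁ / 2) t w := by
        rw [sub_zero, abs_of_nonneg ht]; ring
    _ ≤ 4 * CE * (K * (1 + 2 * c₀)) * max Bm 0 * θ ^ 2 * (1 + t) ^ 2 * gaussProfile (c₁ / 2) t w := by
        gcongr; nlinarith

/-! ## Registered headline -/

/-- Registered headline of this helper file (aux stub `stub_secondOrderExpansionAuxL` of crux
stmt-QuantumFields-16786, line `Sketch`): entries of a summable lattice series of spin matrices. -/
theorem stub_secondOrderExpansionAuxL : ∀ (M : Site 4 → Spin), Summable M → ∀ (α β : Fin 4), (∑' y : Site 4, M y) α β = ∑' y : Site 4, M y α β :=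
  fun _ hM α β => tsum_apply_apply hM α β

end Summit.QuantumFields.QCD.Cruxes.QuarkLoopCoefficient.Sketch.SecondOrderExpansion

end
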